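import Mathlib
import HarnessLib

/-!
# Filtering a two-sided chain by big gaps (the combinatorics of the filtered Voronoi chain)

Topic `Literature/NumberTheory/CubicFields`. The purely combinatorial / real-variable part of the
FILTERED infrastructure of a complex cubic field (Buchmann–Williams 1988 §2, as used for Hallgren-type
period finding over the cycle of reduced ideals): let `a : ℤ → ℝ` be the real conjugates
`σ₁ θ(i)` along a Voronoi chain, so that `a` is positive, strictly increasing, has the SIX-GAP
`2 a i ≤ a (i + 6)` (packing of relative minima), the period `a (i + n₀) = e · a i` (`n₀ ≥ 1`,
`e = σ₁ ε` for the fundamental unit) and a one-step bound `a (i + 1) ≤ B a i` (`B ≥ 1`, Minkowski).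
The BIG-GAP indices `j`, `11 a j ≤ 10 a (j + 1)` (ratio `≥ 11/10`; note `(11/10)^6 < 2`), then

* occur in every window of six consecutive indices (`exists_bigGap_mem_window`);
* are enumerated increasingly by some `s : ℤ → ℤ` with `s 0` the least nonnegative one,
  consecutive values at most `6` apart, and `s (i + nS) = s i + n₀` for some `nS ≥ 1`
  (`exists_bigGap_enumeration`);
* give filtered gaps `log a (s (i+1)) − log a (s i) ∈ [log (11/10), 6 log B]`
  (`log_sub_log_ge_of_bigGap`, `log_sub_log_le_of_gap_le`);
* force `n₀ log 2 ≤ 6 log e` (`mul_log_two_le_of_six_gap`).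

Generic input: strictly increasing maps `ℤ → ℤ` — a subset of `ℤ` unbounded in both directions is
the range of one (`exists_strictMono_range_eq`, via Mathlib's `orderIsoIntOfLinearSuccPredArch`),
two with the same range agreeing at `0` coincide (`eq_of_strictMono_of_range_eq`), and an
enumeration of a periodic set is periodic up to an index shift (`exists_shift_of_periodic_range`,
`apply_add_mul_of_forall_apply_add`).

## References

* J. Buchmann, H. C. Williams, *On the infrastructure of the principal ideal class of an algebraic
  number field of unit rank one*, Math. Comp. 50 (1988), §2.
-/

namespace Literature.NumberTheory.CubicFields

section IntEnumeration

/-- A nonempty subset of `ℤ` without greatest and least elements is the range of a strictly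
increasing map `ℤ → ℤ` (it is a linear locally finite order without top and bottom, hence
order-isomorphic to `ℤ`). [folklore] -/
theorem exists_strictMono_range_eq {S : Set ℤ} (hne : S.Nonempty) (hup : ∀ x ∈ S, ∃ y ∈ S, x < y)
    (hdown : ∀ x ∈ S, ∃ y ∈ S, y < x) : ∃ s : ℤ → ℤ, StrictMono s ∧ Set.range s = S := by
  classical
  haveI : Nonempty S := hne.to_subtype
  haveI : NoMaxOrder S := ⟨fun x => by
    obtain ⟨y, hy, hxy⟩ := hup x.1 x.2
    exact ⟨⟨y, hy⟩, Subtype.coe_lt_coe.mp hxy⟩⟩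
  haveI : NoMinOrder S := ⟨fun x => by
    obtain ⟨y, hy, hxy⟩ := hdown x.1 x.2
    exact ⟨⟨y, hy⟩, Subtype.coe_lt_coe.mp hxy⟩⟩
  letI := LinearLocallyFiniteOrder.succOrder S
  letI := LinearLocallyFiniteOrder.predOrder S
  set e : S ≃o ℤ := orderIsoIntOfLinearSuccPredArch
  refine ⟨fun i => ((e.symm i : S) : ℤ), fun i j hij => Subtype.coe_lt_coe.mpr (e.symm.strictMono hij), ?_⟩
  ext x
  constructor
  · rintro ⟨i, rfl⟩
    exact (e.symm i).2
  · intro hx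
    exact ⟨e ⟨x, hx⟩, by simp⟩

/-- **Uniqueness of enumerations**: two strictly increasing maps `ℤ → ℤ` with the same range that
agree at `0` are equal (step up: `t (i+1)` is the least value above `t i`; step down
symmetrically). [folklore] -/
theorem eq_of_strictMono_of_range_eq {t t' : ℤ → ℤ} (ht : StrictMono t) (ht' : StrictMono t')
    (hr : Set.range t = Set.range t') (h0 : t 0 = t' 0) : t = t' := by
  have up : ∀ {f g : ℤ → ℤ}, StrictMono f → StrictMono g → Set.range f = Set.range g →
      ∀ i, f i = g i → f (i + 1) ≤ g (i + 1) := by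
    intro f g hf hg hfg i hi
    obtain ⟨j, hj⟩ : g (i + 1) ∈ Set.range f := hfg ▸ ⟨i + 1, rfl⟩
    have hlt : f i < f j := by rw [hj, hi]; exact hg (lt_add_one i)
    rw [← hj]
    exact hf.monotone (Int.add_one_le_iff.mpr (hf.lt_iff_lt.mp hlt))
  have down : ∀ {f g : ℤ → ℤ}, StrictMono f → StrictMono g → Set.range f = Set.range g →
      ∀ i, f i = g i → g (i - 1) ≤ f (i - 1) := by
    intro f g hf hg hfg i hi
    obtain ⟨j, hj⟩ : g (i - 1) ∈ Set.range f := hfg ▸ ⟨i - 1, rfl⟩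
    have hlt : f j < f i := by rw [hj, hi]; exact hg (sub_one_lt i)
    rw [← hj]
    exact hf.monotone (Int.le_sub_one_iff.mpr (hf.lt_iff_lt.mp hlt))
  funext i
  induction i with
  | zero => exact h0
  | succ i ih => exact le_antisymm (up ht ht' hr _ ih) (up ht' ht hr.symm _ ih.symm)
  | pred i ih => exact le_antisymm (down ht' ht hr.symm _ ih.symm) (down ht ht' hr _ ih)

/-- **Enumerations of periodic sets are periodic up to a shift**: if the range of the strictly
increasing `s : ℤ → ℤ` is invariant under `x ↦ x + n` (`n > 0`), then `s (i + m) = s i + n` for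
some `m ≥ 1` and all `i`. [folklore] -/
theorem exists_shift_of_periodic_range {s : ℤ → ℤ} (hs : StrictMono s) {n : ℤ} (hn : 0 < n)
    (hper : ∀ x, x ∈ Set.range s ↔ x + n ∈ Set.range s) :
    ∃ m : ℕ, 0 < m ∧ ∀ i, s (i + m) = s i + n := by
  obtain ⟨m, hm⟩ : s 0 + n ∈ Set.range s := (hper _).mp ⟨0, rfl⟩
  have key : (fun i => s (i + m)) = fun i => s i + n := by
    apply eq_of_strictMono_of_range_eq
    · exact fun i j hij => hs (by omega)
    · exact fun i j hij => by simpa using hs hij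
    · ext x
      constructor
      · rintro ⟨i, rfl⟩
        obtain ⟨j, hj⟩ := (hper (s (i + m) - n)).mpr ⟨i + m, by ring⟩
        exact ⟨j, by simp only; omega⟩
      · rintro ⟨i, rfl⟩
        obtain ⟨j, hj⟩ := (hper (s i)).mp ⟨i, rfl⟩
        exact ⟨j - m, by simp only [sub_add_cancel]; exact hj⟩
    · simp only [zero_add]
      exact hm
  have hm0 : 0 < m := by
    have h := congrFun key 0
    simp only [zero_add] at h
    have : s 0 < s m := by rw [h]; linarith
    exact hs.lt_iff_lt.mp this
  refine ⟨m.toNat, by omega, fun i => ?_⟩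
  rw [Int.toNat_of_nonneg hm0.le]
  exact congrFun key i

/-- Iterating a shift relation: `s (i + m) = s i + n` for all `i` gives `s (i + k m) = s i + k n`
for all `k : ℤ`. [folklore] -/
theorem apply_add_mul_of_forall_apply_add {s : ℤ → ℤ} {m n : ℤ} (h : ∀ i, s (i + m) = s i + n)
    (i k : ℤ) : s (i + k * m) = s i + k * n := by
  induction k with
  | zero => simp
  | succ k ih => rw [add_mul, one_mul, ← add_assoc, h, ih]; ring
  | pred k ih =>
    have h1 := h (i + (-(k : ℤ) - 1) * m)
    rw [show i + (-(k : ℤ) - 1) * m + m = i + (-(k : ℤ)) * m by ring, ih] at h1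
    linarith

end IntEnumeration

section BigGap

variable {a : ℤ → ℝ} (hpos : ∀ i, 0 < a i) (hmono : StrictMono a) (h6 : ∀ i, 2 * a i ≤ a (i + 6))

include hpos h6 in
/-- **A big gap in every window of six**: if `2 a i ≤ a (i + 6)` and `a > 0` then some
`j ∈ [i, i + 5]` has `11 a j ≤ 10 a (j + 1)` (otherwise `a (i + 6) < (11/10)^6 a i < 2 a i`).
[folklore] -/
theorem exists_bigGap_mem_window (i : ℤ) : ∃ j, i ≤ j ∧ j ≤ i + 5 ∧ 11 * a j ≤ 10 * a (j + 1) := by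
  by_contra! hcon
  have h0 := hcon i le_rfl (by omega)
  have h1 := hcon (i + 1) (by omega) (by omega)
  have h2 := hcon (i + 2) (by omega) (by omega)
  have h3 := hcon (i + 3) (by omega) (by omega)
  have h4 := hcon (i + 4) (by omega) (by omega)
  have h5 := hcon (i + 5) (by omega) (by omega)
  rw [show i + 1 + 1 = i + 2 by ring] at h1
  rw [show i + 2 + 1 = i + 3 by ring] at h2
  rw [show i + 3 + 1 = i + 4 by ring] at h3
  rw [show i + 4 + 1 = i + 5 by ring] at h4
  rw [show i + 5 + 1 = i + 6 by ring] at h5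
  have h7 := h6 i
  have h8 := hpos i
  linarith

include hpos h6 in
/-- **The increasing enumeration of the big-gap indices.** For `a : ℤ → ℝ` positive, strictly
increasing, with the six-gap and the period `a (i + n₀) = e a i` (`n₀ ≥ 1`): the indices `j` with
`11 a j ≤ 10 a (j + 1)` are the values of a strictly increasing `s : ℤ → ℤ`, normalised by
`s 0 =` the least nonnegative one, with `s (i + 1) ≤ s i + 6` and `s (i + nS) = s i + n₀` for some
`nS ≥ 1`. [folklore] -/
theorem exists_bigGap_enumeration {n₀ : ℕ} (hn₀ : 0 < n₀) {e : ℝ} (hper : ∀ i, a (i + n₀) = e * a i) :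
    ∃ (s : ℤ → ℤ) (nS : ℕ), StrictMono s ∧
      (∀ i, 11 * a (s i) ≤ 10 * a (s i + 1)) ∧
      (∀ j, 11 * a j ≤ 10 * a (j + 1) → ∃ i, s i = j) ∧
      0 ≤ s 0 ∧ (∀ j, 0 ≤ j → 11 * a j ≤ 10 * a (j + 1) → s 0 ≤ j) ∧
      (∀ i, s (i + 1) ≤ s i + 6) ∧
      0 < nS ∧ (∀ i, s (i + nS) = s i + n₀) := by
  set S : Set ℤ := {j | 11 * a j ≤ 10 * a (j + 1)} with hS
  have he : 0 < e := by
    have h := hper 0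
    have h1 := hpos (0 + (n₀ : ℤ))
    have h2 := hpos 0
    rw [h] at h1
    exact (mul_pos_iff_of_pos_right h2).mp h1
  -- `S` is `n₀`-periodic, nonempty, without greatest or least element
  have hSper : ∀ x, x ∈ S ↔ x + n₀ ∈ S := fun x => by
    simp only [hS, Set.mem_setOf_eq]
    rw [show x + n₀ + 1 = (x + 1) + n₀ by ring, hper, hper, mul_left_comm, mul_left_comm 10,
      mul_le_mul_iff_of_pos_left he]
  have hne : S.Nonempty := by
    obtain ⟨j, -, -, hj⟩ := exists_bigGap_mem_window hpos h6 0
    exact ⟨j, hj⟩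
  have hup : ∀ x ∈ S, ∃ y ∈ S, x < y := fun x _ => by
    obtain ⟨j, h1, -, hj⟩ := exists_bigGap_mem_window hpos h6 (x + 1)
    exact ⟨j, hj, by omega⟩
  have hdown : ∀ x ∈ S, ∃ y ∈ S, y < x := fun x _ => by
    obtain ⟨j, -, h2, hj⟩ := exists_bigGap_mem_window hpos h6 (x - 6)
    exact ⟨j, hj, by omega⟩
  obtain ⟨s₀, hs₀, hr₀⟩ := exists_strictMono_range_eq hne hup hdown
  -- the least nonnegative element of `S`
  obtain ⟨j₀, ⟨hj₀S, hj₀0⟩, hj₀min⟩ :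
      ∃ j₀, (j₀ ∈ S ∧ 0 ≤ j₀) ∧ ∀ j, (j ∈ S ∧ 0 ≤ j) → j₀ ≤ j := by
    obtain ⟨j, h1, -, hj⟩ := exists_bigGap_mem_window hpos h6 0
    exact Int.exists_least_of_bdd ⟨0, fun z hz => hz.2⟩ ⟨j, hj, h1⟩
  obtain ⟨i₀, hi₀⟩ : j₀ ∈ Set.range s₀ := by rw [hr₀]; exact hj₀S
  -- normalise the enumeration
  set s : ℤ → ℤ := fun i => s₀ (i + i₀) with hs
  have hsm : StrictMono s := fun i j hij => hs₀ (by omega)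
  have hrs : Set.range s = S := by
    rw [← hr₀]
    ext x
    constructor
    · rintro ⟨i, rfl⟩
      exact ⟨i + i₀, rfl⟩
    · rintro ⟨i, rfl⟩
      exact ⟨i - i₀, by simp [hs]⟩
  have hs0 : s 0 = j₀ := by simp [hs, hi₀]
  obtain ⟨nS, hnS, hnSper⟩ := exists_shift_of_periodic_range hsm (by exact_mod_cast hn₀ : (0 : ℤ) < n₀)
    (by rw [hrs]; exact hSper)
  refine ⟨s, nS, hsm, fun i => ?_, fun j hj => ?_, by rw [hs0]; exact hj₀0,
    fun j hj hjS => by rw [hs0]; exact hj₀min j ⟨hjS, hj⟩, fun i => ?_, hnS, hnSper⟩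
  · have h : s i ∈ S := by rw [← hrs]; exact ⟨i, rfl⟩
    exact h
  · have h : j ∈ Set.range s := by rw [hrs]; exact hj
    exact h
  · -- six-step spacing: the window `[s i + 1, s i + 6]` contains a big-gap index
    obtain ⟨j, h1, h2, hj⟩ := exists_bigGap_mem_window hpos h6 (s i + 1)
    obtain ⟨k, hk⟩ : j ∈ Set.range s := by rw [hrs]; exact hj
    have hlt : s i < s k := by omega
    have hik := hsm.lt_iff_lt.mp hlt
    calc s (i + 1) ≤ s k := hsm.monotone (by omega)
      _ ≤ s i + 6 := by omega

include hpos hmono in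
/-- **Lower bound for a filtered gap**: `log a (s (i+1)) − log a (s i) ≥ log (11/10)` when `s i`
is a big-gap index and `s` is strictly increasing. [folklore] -/
theorem log_sub_log_ge_of_bigGap {s : ℤ → ℤ} (hsm : StrictMono s)
    (hbig : ∀ i, 11 * a (s i) ≤ 10 * a (s i + 1)) (i : ℤ) :
    Real.log (11 / 10) ≤ Real.log (a (s (i + 1))) - Real.log (a (s i)) := by
  have h1 := hbig i
  have h2 : a (s i + 1) ≤ a (s (i + 1)) := hmono.monotone (Int.add_one_le_iff.mpr (hsm (lt_add_one i)))
  have ha := hpos (s i)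
  have hb : 11 / 10 * a (s i) ≤ a (s (i + 1)) := by linarith
  rw [le_sub_iff_add_le, ← Real.log_mul (by norm_num) ha.ne']
  exact Real.log_le_log (by positivity) hb

/-- Iterating a one-step bound: `a (i + m) ≤ B ^ m a i` (`B ≥ 0`). [folklore] -/
theorem apply_add_le_pow_mul {B : ℝ} (hB : 0 ≤ B) (hgap : ∀ i, a (i + 1) ≤ B * a i) (i : ℤ) (m : ℕ) :
    a (i + m) ≤ B ^ m * a i := by
  induction m with
  | zero => simp
  | succ m ih =>
    calc a (i + ((m + 1 : ℕ) : ℤ)) = a (i + m + 1) := by push_cast; rw [add_assoc]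
      _ ≤ B * a (i + m) := hgap _
      _ ≤ B * (B ^ m * a i) := mul_le_mul_of_nonneg_left ih hB
      _ = B ^ (m + 1) * a i := by ring

include hpos in
/-- **Upper bound for a filtered gap**: with `a (i+1) ≤ B a i` (`B ≥ 1`) and consecutive values of
`s` at most `6` apart, `log a (s (i+1)) − log a (s i) ≤ 6 log B`. [folklore] -/
theorem log_sub_log_le_of_gap_le {B : ℝ} (hB : 1 ≤ B) (hgap : ∀ i, a (i + 1) ≤ B * a i) {s : ℤ → ℤ}
    (hsm : StrictMono s) (h6s : ∀ i, s (i + 1) ≤ s i + 6) (i : ℤ) :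
    Real.log (a (s (i + 1))) - Real.log (a (s i)) ≤ 6 * Real.log B := by
  obtain ⟨m, hm⟩ : ∃ m : ℕ, s (i + 1) = s i + m :=
    ⟨(s (i + 1) - s i).toNat, by have := hsm (lt_add_one i); omega⟩
  have hm6 : m ≤ 6 := by have := h6s i; omega
  have hB0 : 0 ≤ B := by linarith
  have h1 : a (s (i + 1)) ≤ B ^ m * a (s i) := by rw [hm]; exact apply_add_le_pow_mul hB0 hgap _ _
  have h2 : B ^ m ≤ B ^ 6 := pow_le_pow_right₀ hB hm6
  have ha := hpos (s i)
  have h3 : a (s (i + 1)) ≤ B ^ 6 * a (s i) := h1.trans (mul_le_mul_of_nonneg_right h2 ha.le)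
  have h6log : (6 : ℝ) * Real.log B = Real.log (B ^ 6) := by rw [Real.log_pow]; norm_num
  rw [sub_le_iff_le_add, h6log, ← Real.log_mul (by positivity) ha.ne']
  exact Real.log_le_log (hpos _) h3

include hpos h6 in
/-- **The period is at most `6 R / log 2` steps**: from the six-gap, `2 ^ n₀ a 0 ≤ a (6 n₀) = e ^ 6 a 0`,
so `n₀ log 2 ≤ 6 log e`. [folklore] -/
theorem mul_log_two_le_of_six_gap {n₀ : ℕ} {e : ℝ} (hper : ∀ i, a (i + n₀) = e * a i) :
    (n₀ : ℝ) * Real.log 2 ≤ 6 * Real.log e := by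
  have he : 0 < e := by
    have h := hper 0
    have h1 := hpos (0 + (n₀ : ℤ))
    have h2 := hpos 0
    rw [h] at h1
    exact (mul_pos_iff_of_pos_right h2).mp h1
  have hiter : ∀ n : ℕ, 2 ^ n * a 0 ≤ a (6 * n) := by
    intro n
    induction n with
    | zero => simp
    | succ n ih =>
      calc (2 : ℝ) ^ (n + 1) * a 0 = 2 * (2 ^ n * a 0) := by ring
        _ ≤ 2 * a (6 * n) := by linarith
        _ ≤ a (6 * n + 6) := h6 _
        _ = a (6 * ((n + 1 : ℕ) : ℤ)) := by push_cast; ring_nf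
  have hperk : ∀ k : ℕ, a (k * n₀) = e ^ k * a 0 := by
    intro k
    induction k with
    | zero => simp
    | succ k ih =>
      calc a (((k + 1 : ℕ) : ℤ) * n₀) = a (k * n₀ + n₀) := by push_cast; ring_nf
        _ = e * a (k * n₀) := hper _
        _ = e ^ (k + 1) * a 0 := by rw [ih]; ring
  have h := hiter n₀
  rw [show (6 : ℤ) * ((n₀ : ℕ) : ℤ) = ((6 : ℕ) : ℤ) * n₀ by push_cast; ring, hperk 6] at h
  have ha := hpos 0
  have h' : (2 : ℝ) ^ n₀ ≤ e ^ 6 := le_of_mul_le_mul_right h ha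
  have hlog := Real.log_le_log (by positivity) h'
  rw [Real.log_pow, Real.log_pow] at hlog
  push_cast at hlog
  linarith

end BigGap

end Literature.NumberTheory.CubicFields
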